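import Mathlib
import Literature.NumberTheory.Transcendental.KZCalculus
import Literature.NumberTheory.Transcendental.SemialgebraicMapsProofs
import Literature.NumberTheory.Transcendental.KZProductIdeal
import Literature.NumberTheory.Transcendental.EllIterRepShuffle
import Literature.NumberTheory.Transcendental.KZLogCalculusProofs
import Summits.KontsevichZagierPeriods.KontsevichZagierPeriods.Theorems.TorsionLogsNeronTorsionSectorStubFibreNL
import HarnessLib

/-!
# Stub `stub_fibreNLWeighted` — crux `TorsionLogs.NeronTorsionSector`, line `registered` (block W3)

The weighted form of `stub_fibreNL`: Kontsevich–Zagier's rule (3) (Newton–Leibniz along the last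
coordinate, `KZ.newtonLeibnizRel`) in the inner variable `x′` for band integrands
`k(x′)·w₀(x)·w₁(x′)` with an arbitrary `ℚ`-semialgebraic base weight `w₀` (needed in the
compactifying chart `s = x^{-1/2}` at infinity, where the Haar density is `2/√(4 − g₂s⁴ − g₃s⁶)`).
Over a `ℚ`-semialgebraic base `A` with `ℚ`-semialgebraic fibre bounds `c < d` whose closed fibres lie
in a set `J` on which the potential `Q` is `ℚ`-semialgebraic, `Q` continuous on each closed fibre
with `Q′ = −k·w₁` on the open fibre, the OPEN band representation `rS = [S, k(x′)·w₀(x)·w₁(x′)]`,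
`S = {x ∈ A, c x < x′ < d x}`, and the base representation `rB = [A, (Q(c x) − Q(d x))·w₀(x)]`
differ by a relation of the KZ calculus:

* the CLOSED band `R = [{x ∈ A, c x ≤ x′ ≤ d x}, 𝟙_S · rS.integrand]` (`KZlog.band`,
  `KZlog.isSemialgebraic_band`; the extension by zero of a semialgebraic function is semialgebraic,
  `isSemialgebraicFunOn_indicator_of_subset`) differs from `rS` by the two graphs `x′ = c x`,
  `x′ = d x`, which are Lebesgue-null (`KZ.volume_graph_eq_zero`), so `[R] − [rS] ∈ relations` by
  domain additivity (`KZ.of_sub_sum_of_mem_relations_of_subset` with a one-piece family);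
* `[R] − [rB]` is ONE Newton–Leibniz move with primitive `F(x, x′) = −Q(x′)·w₀(x)`:
  `∂F/∂x′ = k(x′)·w₁(x′)·w₀(x)` on the open fibre (the derivative hypothesis already carries `w₁`,
  so no hypothesis on `w₁` is needed), `F(x, d x) − F(x, c x) = (Q(c x) − Q(d x))·w₀(x)`.

References: M. Kontsevich, D. Zagier, *Periods* (2001), §1.2 rule (3); J. Bochnak, M. Coste,
M.-F. Roy, *Real Algebraic Geometry* (1998), §2.2.
-/

noncomputable section

-- `Summit.KontsevichZagierPeriods.KontsevichZagierPeriods.…` is the tree's mandated layout (single-conjunct summit).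
set_option linter.dupNamespace false

open Set MeasureTheory MvPolynomial
open Literature.NumberTheory.Transcendental Literature.ModelTheory.ExponentialFields
open Literature.NumberTheory.Transcendental.KZ

namespace Summit.KontsevichZagierPeriods.KontsevichZagierPeriods.Cruxes.NeronTorsionSector.Translation

/-- **STUB W3 (`stub_fibreNLWeighted`) — rule (3) in the inner variable with arbitrary weights**
(the weighted form of `stub_fibreNL`, needed in the compactifying chart `s = x^{-1/2}` at infinity where the
Haar density is `2/√(4 − g₂s⁴ − g₃s⁶)` instead of `1/√f`). Over a `ℚ`-semialgebraic base `A` with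
`ℚ`-semialgebraic fibre bounds `c < d` (closed fibres inside `J`), a potential `Q` (`ℚ`-semialgebraic on `J`,
continuous on each closed fibre, `Q′ = −k·w₁` on the open fibre) and a `ℚ`-semialgebraic base weight `w₀`:
the band representation `[S, k(x′)·w₀(x)·w₁(x′)]` is KZ-equivalent to `[A, (Q(c x) − Q(d x))·w₀(x)]` — one move
of `KZ.newtonLeibnizRel` with primitive `F(x, x′) = −Q(x′)·w₀(x)` on the closed band (null graphs of `c`, `d`
as in `stub_fibreNL`). [cite: KontsevichZagier2001, §1.2 rule (3)] -/
theorem stub_fibreNLWeighted :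
    ∀ (k Q c d w₀ w₁ : ℝ → ℝ) (A J : Set ℝ)
      (rS : Literature.NumberTheory.Transcendental.KZ.IntegralRep 2)
      (rB : Literature.NumberTheory.Transcendental.KZ.IntegralRep 1),
    IsSemialgebraic ℚ {t : Fin 1 → ℝ | t 0 ∈ A} →
    IsSemialgebraicFunOn ℚ {t : Fin 1 → ℝ | t 0 ∈ A} (fun t => c (t 0)) →
    IsSemialgebraicFunOn ℚ {t : Fin 1 → ℝ | t 0 ∈ A} (fun t => d (t 0)) →
    IsSemialgebraicFunOn ℚ {t : Fin 1 → ℝ | t 0 ∈ A} (fun t => w₀ (t 0)) →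
    (∀ x ∈ A, c x < d x) → (∀ x ∈ A, Set.Icc (c x) (d x) ⊆ J) →
    IsSemialgebraic ℚ {t : Fin 1 → ℝ | t 0 ∈ J} →
    IsSemialgebraicFunOn ℚ {t : Fin 1 → ℝ | t 0 ∈ J} (fun t => Q (t 0)) →
    (∀ x ∈ A, ContinuousOn Q (Set.Icc (c x) (d x))) →
    (∀ x ∈ A, ∀ x' ∈ Set.Ioo (c x) (d x), HasDerivAt Q (-(k x' * w₁ x')) x') →
    rS.domain = {z | z 0 ∈ A ∧ c (z 0) < z 1 ∧ z 1 < d (z 0)} →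
    Set.EqOn rS.integrand (fun z => k (z 1) * w₀ (z 0) * w₁ (z 1)) rS.domain →
    rB.domain = {t | t 0 ∈ A} →
    Set.EqOn rB.integrand (fun t => (Q (c (t 0)) - Q (d (t 0))) * w₀ (t 0)) rB.domain →
    Literature.NumberTheory.Transcendental.KZ.of rS - Literature.NumberTheory.Transcendental.KZ.of rB ∈
      Literature.NumberTheory.Transcendental.KZ.relations := by
  intro k Q c d w₀ w₁ A J rS rB _hAsa hc hd hw₀ hcd hJcd _hJsa hQ hQc hQd hSd hSi hBd hBi
  -- notation: fibre bounds on the base `rB.domain = {t | t 0 ∈ A}` and the primitive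
  set a : (Fin 1 → ℝ) → ℝ := fun t => c (t 0) with ha
  set b : (Fin 1 → ℝ) → ℝ := fun t => d (t 0) with hb
  set F : (Fin 2 → ℝ) → ℝ := fun z => -Q (z 1) * w₀ (z 0) with hF
  have hsnoc0 : ∀ (p : Fin 1 → ℝ) (t : ℝ), (Fin.snoc p t : Fin 2 → ℝ) 0 = p 0 := fun p t => by
    simp [Fin.snoc]
  have hsnoc1 : ∀ (p : Fin 1 → ℝ) (t : ℝ), (Fin.snoc p t : Fin 2 → ℝ) 1 = t := fun p t => by
    simp [Fin.snoc]
  have hmemS : ∀ z, z ∈ rS.domain ↔ z 0 ∈ A ∧ c (z 0) < z 1 ∧ z 1 < d (z 0) := fun z => by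
    rw [hSd, mem_setOf_eq]
  have hmemB : ∀ t, t ∈ rB.domain ↔ t 0 ∈ A := fun t => by rw [hBd, mem_setOf_eq]
  -- the base data
  have hasa : IsSemialgebraicFunOn ℚ rB.domain a := by rw [hBd]; exact hc
  have hbsa : IsSemialgebraicFunOn ℚ rB.domain b := by rw [hBd]; exact hd
  have hab : ∀ x ∈ rB.domain, a x ≤ b x := fun x hx => (hcd (x 0) ((hmemB x).1 hx)).le
  -- the closed band `{x ∈ A, c x ≤ x' ≤ d x}`
  have hDsa : IsSemialgebraic ℚ (KZlog.band rB.domain a b) := KZlog.isSemialgebraic_band hasa hbsa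
  have hDA : ∀ z ∈ KZlog.band rB.domain a b, z 0 ∈ A := fun z hz =>
    (hmemB _).1 (KZlog.mem_band.1 hz).1
  have hDJ : ∀ z ∈ KZlog.band rB.domain a b, z 1 ∈ J := fun z hz => by
    obtain ⟨hzB, h1, h2⟩ := KZlog.mem_band.1 hz
    exact hJcd (z 0) ((hmemB _).1 hzB) ⟨h1, h2⟩
  have hSD : rS.domain ⊆ KZlog.band rB.domain a b := fun z hz => by
    obtain ⟨hzA, h1, h2⟩ := (hmemS z).1 hz
    exact KZlog.mem_band.2 ⟨(hmemB _).2 hzA, h1.le, h2.le⟩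
  -- the closed band minus the open one lies in the two (null) graphs of `c` and `d`
  have hcover : KZlog.band rB.domain a b \ rS.domain ⊆
      {z : Fin 2 → ℝ | Fin.init z ∈ rB.domain ∧ z (Fin.last 1) = a (Fin.init z)} ∪
        {z : Fin 2 → ℝ | Fin.init z ∈ rB.domain ∧ z (Fin.last 1) = b (Fin.init z)} := by
    rintro z ⟨hzD, hzS⟩
    obtain ⟨hzB, h1, h2⟩ := KZlog.mem_band.1 hzD
    have hzA : z 0 ∈ A := (hmemB _).1 hzB
    rw [hmemS] at hzS
    change c (z 0) ≤ z 1 at h1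
    change z 1 ≤ d (z 0) at h2
    rcases h1.eq_or_lt with h | h
    · exact Or.inl ⟨hzB, h.symm⟩
    · rcases h2.eq_or_lt with h' | h'
      · exact Or.inr ⟨hzB, h'⟩
      · exact (hzS ⟨hzA, h, h'⟩).elim
  have hnull : volume (KZlog.band rB.domain a b \ rS.domain) = 0 :=
    measure_mono_null hcover
      (measure_union_null (volume_graph_eq_zero hasa) (volume_graph_eq_zero hbsa))
  -- the band integrand: the extension by zero of the integrand of `rS`
  have hGsa : IsSemialgebraicFunOn ℚ (KZlog.band rB.domain a b) (rS.domain.indicator rS.integrand) :=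
    isSemialgebraicFunOn_indicator_of_subset hDsa rS.isSemialgebraic_domain hSD
      rS.isSemialgebraicFunOn_integrand
  have hmeasS : MeasurableSet rS.domain := IsSemialgebraic.measurableSet_holds rS.isSemialgebraic_domain
  have hGint : IntegrableOn (rS.domain.indicator rS.integrand) (KZlog.band rB.domain a b) :=
    ((integrable_indicator_iff hmeasS).2 rS.integrableOn).integrableOn
  obtain ⟨R, hRd, hRi⟩ : ∃ R : IntegralRep 2, R.domain = KZlog.band rB.domain a b ∧
      R.integrand = rS.domain.indicator rS.integrand :=
    ⟨⟨_, _, hDsa, hGsa, hGint⟩, rfl, rfl⟩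
  -- (i) `[R] − [rS]`: domain additivity with a one-piece family and a null remainder
  have h1 : of R - of rS ∈ relations := by
    have key := of_sub_sum_of_mem_relations_of_subset (Finset.univ : Finset Unit) R (fun _ => rS)
      (fun _ _ z hz => by rw [hRd]; exact hSD hz)
      (fun _ _ z hz => by rw [hRi, Set.indicator_of_mem hz]) ?_
      (Set.subsingleton_of_subsingleton.pairwise _)
    · simpa using key
    · have hU : (⋃ i ∈ (Finset.univ : Finset Unit), ((fun _ : Unit => rS) i).domain) = rS.domain := by
        ext z
        simp
      rw [hU, hRd]
      exact hnull
  -- (ii) `[R] − [rB]`: ONE Newton–Leibniz move with primitive `F(x, x') = -Q(x') * w₀(x)`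
  have hZ0 : IsSemialgebraicFunOn ℚ (KZlog.band rB.domain a b) (fun z => z 0) :=
    (isSemialgebraicFunOn_aeval hDsa (X 0 : MvPolynomial (Fin 2) ℚ)).congr fun z _ => by simp
  have hZ1 : IsSemialgebraicFunOn ℚ (KZlog.band rB.domain a b) (fun z => z 1) :=
    (isSemialgebraicFunOn_aeval hDsa (X 1 : MvPolynomial (Fin 2) ℚ)).congr fun z _ => by simp
  have hproj0 : IsSemialgebraicMapOn ℚ (KZlog.band rB.domain a b) (fun z (_ : Fin 1) => z 0) :=
    IsSemialgebraicMapOn.of_forall hDsa fun _ => hZ0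
  have hproj1 : IsSemialgebraicMapOn ℚ (KZlog.band rB.domain a b) (fun z (_ : Fin 1) => z 1) :=
    IsSemialgebraicMapOn.of_forall hDsa fun _ => hZ1
  have hQD : IsSemialgebraicFunOn ℚ (KZlog.band rB.domain a b) (fun z => Q (z 1)) :=
    IsSemialgebraicFunOn.comp_isSemialgebraicMapOn_holds (g := fun t : Fin 1 → ℝ => Q (t 0)) hQ hproj1
      fun z hz => hDJ z hz
  have hw₀D : IsSemialgebraicFunOn ℚ (KZlog.band rB.domain a b) (fun z => w₀ (z 0)) :=
    IsSemialgebraicFunOn.comp_isSemialgebraicMapOn_holds (g := fun t : Fin 1 → ℝ => w₀ (t 0)) hw₀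
      hproj0 fun z hz => hDA z hz
  have hFsa : IsSemialgebraicFunOn ℚ R.domain F := by
    rw [hRd]
    exact (IsSemialgebraicFunOn.mul_holds hQD.neg hw₀D).congr fun z _ => by
      simp only [hF, Pi.mul_apply, Pi.neg_apply, neg_mul]
  have hFfib : ∀ x : Fin 1 → ℝ, (fun s : ℝ => F (Fin.snoc x s)) =
      fun s => -Q s * w₀ (x 0) := fun x => by
    ext s
    simp only [hF, hsnoc0, hsnoc1]
  have hcont : ∀ x ∈ rB.domain, ContinuousOn (fun t : ℝ => F (Fin.snoc x t)) (Icc (a x) (b x)) := by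
    intro x hx
    rw [hFfib]
    exact ((hQc (x 0) ((hmemB x).1 hx)).neg).mul continuousOn_const
  have hder : ∀ x ∈ rB.domain, ∀ t ∈ Ioo (a x) (b x),
      HasDerivAt (fun s : ℝ => F (Fin.snoc x s)) (R.integrand (Fin.snoc x t)) t := by
    intro x hx t ht
    have hxA : x 0 ∈ A := (hmemB x).1 hx
    have ht' : c (x 0) < t ∧ t < d (x 0) := ht
    have hmemt : (Fin.snoc x t : Fin 2 → ℝ) ∈ rS.domain := by
      rw [hmemS]
      simp only [hsnoc0, hsnoc1]
      exact ⟨hxA, ht'.1, ht'.2⟩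
    have hRint : R.integrand (Fin.snoc x t) = k t * w₀ (x 0) * w₁ t := by
      rw [hRi, Set.indicator_of_mem hmemt, hSi hmemt]
      simp only [hsnoc0, hsnoc1]
    rw [hRint, hFfib]
    have key : HasDerivAt (fun s : ℝ => -Q s * w₀ (x 0))
        (-(-(k t * w₁ t)) * w₀ (x 0)) t :=
      ((hQd (x 0) hxA t ht').neg).mul_const _
    refine key.congr_deriv ?_
    ring
  have hbase : ∀ x ∈ rB.domain, rB.integrand x = F (Fin.snoc x (b x)) - F (Fin.snoc x (a x)) := by
    intro x hx
    rw [hBi hx]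
    simp only [hF, ha, hb, hsnoc0, hsnoc1]
    ring
  have h2 : of R - of rB ∈ relations :=
    newtonLeibnizRel_subset_relations
      ⟨1, R, rB, a, b, F, hFsa, hasa, hbsa, hab, hRd, hcont, hder, hbase, rfl⟩
  -- assemble
  have e : of rS - of rB = (of R - of rB) - (of R - of rS) := by abel
  rw [e]
  exact relations.sub_mem h2 h1

end Summit.KontsevichZagierPeriods.KontsevichZagierPeriods.Cruxes.NeronTorsionSector.Translation

end
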